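import Literature.Computability.AlgebraicComplexity.CKSV22FormulaLowerBound
import Literature.Computability.AlgebraicComplexity.CKSV22HomogeneousSingularLocusBounds
import HarnessLib

/-!
# CKSV 2022, §1.5 closing remark, formula side: a formula lower bound from a (robust) singular-locus bound

P. Chatterjee, M. Kumar, A. She, B. L. Volk, *Quadratic lower bounds for algebraic branching programs
and formulas*, comput. complex. **31** (2022) 8 (arXiv:1911.11793), §1.5 (TeX L205): "In general,
these lower bounds hold for any family of polynomials of high enough degree whose zeroes of
multiplicity at least two lie in a low dimensional variety, or more formally, an analog of Claim 9
or Lemma 24 is true." This file is the FORMULA half of that sentence (the ABP half is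
`CKSV22RobustSingularLocusABPBound` / `CKSV22UnlayeredABPRobustBound` /
`CKSV22HomogeneousSingularLocusBounds`), assembled in this tree along the proof of Theorem 3
(`CKSV22FormulaLowerBound`):

* `CKSV2022.formula_lower_bound_of_robustHeight` — if for all `g_i` of degree `≤ d − 2` every prime
  containing all `∂_i f − g_i` has height `≥ c` ("an analog of Lemma 24"), then every formula
  (`CKSV2022.Formula`, size = number of variable leaves) computing `f + Σ_{j<r} A_jB_j + R` with
  `A_j(0) = B_j(0) = 0`, `deg R < d` has `(c − 2r)·⌊d/3⌋ ≤ 2·size` (`3 ≤ d`): one application of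
  Lemma 30 with threshold `⌊d/3⌋` and the robust counting step
  `CKSV2022.le_two_mul_card_of_eq_sum_mul_add`.
* `CKSV2022.formula_lower_bound_of_isHomogeneous` — for `f` homogeneous of degree `d ≥ 3` the plain
  bound "every prime `⊇ (∂_i f)` has height `≥ c`" suffices (Lemma 25,
  `robustHeight_of_isHomogeneous`): every formula computing `f` has `c·⌊d/3⌋ ≤ 2·size`.
  Instances: `e_{n,d}` (`c = n − (d−2)`, `chatterjeeKumarSheVolk2022_thm_3`), `Σ x_i^d` (`c = n`,
  `formula_lower_bound_psum`).

D-0026: no named facts, no definitions.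

## References
* [ChatterjeeKumarSheVolk2022] — §1.5 (closing remark), Lemma 30, Thm. 31, Thm. 3, Claim 9, Lemma 25.
-/

noncomputable section

open MvPolynomial Finset

namespace Literature.Computability.AlgebraicComplexity

namespace CKSV2022

open Kumar2019 Formula

variable {K : Type*} [Field K] {n : ℕ}

/-- **Formula lower bound from a robust singular-locus bound** (CKSV §1.5 closing remark, formula
side; the proof of Thm. 31 run for an arbitrary `f`): `(c − 2r)·⌊d/3⌋ ≤ 2·size` for every formula
computing `f + Σ_{j<r} A_jB_j + R`, `A_j(0) = B_j(0) = 0`, `deg R < d`, `3 ≤ d`. Assembled in this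
tree. [cite: ChatterjeeKumarSheVolk2022, §1.5 (closing remark), Theorem 31 (proof)] -/
theorem formula_lower_bound_of_robustHeight {d r c : ℕ} (hd : 3 ≤ d) {f : MvPolynomial (Fin n) K}
    (hc : ∀ g : Fin n → MvPolynomial (Fin n) K, (∀ i, (g i).totalDegree ≤ d - 2) →
      ∀ 𝔭 : Ideal (MvPolynomial (Fin n) K), 𝔭.IsPrime → (∀ i, pderiv i f - g i ∈ 𝔭) →
        (c : ℕ∞) ≤ 𝔭.height)
    (Φ : Formula n K) (A B : Fin r → MvPolynomial (Fin n) K)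
    (hA0 : ∀ j, constantCoeff (A j) = 0) (hB0 : ∀ j, constantCoeff (B j) = 0)
    (R : MvPolynomial (Fin n) K) (hRd : R.totalDegree < d)
    (h : Φ.eval = f + ∑ j, A j * B j + R) :
    (c - 2 * r) * (d / 3) ≤ 2 * Φ.size := by
  classical
  have ht : 1 ≤ d / 3 := (Nat.le_div_iff_mul_le (by norm_num)).2 (by omega)
  obtain ⟨k, g, hh, Φ', c₀, hg0, hh0, hΦ'd, -, hkt, hdec⟩ := lemma_30 ht Φ
  have hrem : (Φ'.eval + C c₀ - R).totalDegree < d := by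
    refine Nat.lt_of_le_of_lt (totalDegree_sub _ _) (max_lt ?_ hRd)
    refine Nat.lt_of_le_of_lt (totalDegree_add _ _) (max_lt ?_ ?_)
    · have h1 := totalDegree_eval_le_fdeg Φ'
      have h2 : 2 * (d / 3) - 1 < d := by omega
      omega
    · rw [totalDegree_C]; omega
  have key : f =
      ∑ x : Fin k ⊕ Fin r, Sum.elim g (fun j => -A j) x * Sum.elim hh B x +
        (Φ'.eval + C c₀ - R) := by
    rw [Fintype.sum_sum_type]
    simp only [Sum.elim_inl, Sum.elim_inr, neg_mul, Finset.sum_neg_distrib]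
    have : f = Φ.eval - ∑ j, A j * B j - R := by rw [h]; ring
    rw [this, hdec]; ring
  have hcount := le_two_mul_card_of_eq_sum_mul_add hc _ _ (fun x => ?_) (fun x => ?_) _ hrem key
  rotate_left
  · rcases x with i | j
    · exact hg0 i
    · simp [hA0 j]
  · rcases x with i | j
    · exact hh0 i
    · exact hB0 j
  · rw [Fintype.card_sum, Fintype.card_fin, Fintype.card_fin] at hcount
    have h1 : c - 2 * r ≤ 2 * k := by omega
    calc (c - 2 * r) * (d / 3) ≤ 2 * k * (d / 3) := Nat.mul_le_mul_right _ h1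
      _ = 2 * (k * (d / 3)) := by ring
      _ ≤ 2 * Φ.size := Nat.mul_le_mul_left 2 hkt

/-- **Formula lower bound for a homogeneous `f` from `codim 𝕍(∂f) ≥ c` alone** (CKSV §1.5 closing
remark; Lemma 25 supplies the robustness): if `f` is homogeneous of degree `d ≥ 3` and every prime
containing all `∂_i f` has height `≥ c`, then every formula computing `f` has `c·⌊d/3⌋ ≤ 2·size`.
Assembled in this tree. [cite: ChatterjeeKumarSheVolk2022, §1.5 (closing remark), Theorem 3] -/
theorem formula_lower_bound_of_isHomogeneous {d c : ℕ} (hd : 3 ≤ d) {f : MvPolynomial (Fin n) K}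
    (hf : f.IsHomogeneous d)
    (hc : ∀ P : Ideal (MvPolynomial (Fin n) K), P.IsPrime → (∀ i, pderiv i f ∈ P) →
      (c : ℕ∞) ≤ P.height)
    (Φ : Formula n K) (h : Φ.eval = f) : c * (d / 3) ≤ 2 * Φ.size := by
  have h' : Φ.eval = f + ∑ j : Fin 0, (0 : MvPolynomial (Fin n) K) * 0 + 0 := by simp [h]
  have := formula_lower_bound_of_robustHeight hd (robustHeight_of_isHomogeneous (by omega) hf hc)
    Φ (fun _ => 0) (fun _ => 0) (fun _ => by simp) (fun _ => by simp) 0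
    (by rw [totalDegree_zero]; omega) h'
  simpa using this

/-- The instance `Σ x_i^d` (`c = n`, CKSV Claim 9 in height form `robustHeight_psum`): every
formula computing `Σ_{i<n} x_i^d` (`3 ≤ d`, `(d : K) ≠ 0`) has `n·⌊d/3⌋ ≤ 2·size`.
[cite: ChatterjeeKumarSheVolk2022, §1.5 (closing remark), Claim 9] -/
theorem formula_lower_bound_psum {d : ℕ} (hd : 3 ≤ d) (hdK : (d : K) ≠ 0) (Φ : Formula n K)
    (h : Φ.eval = psum (Fin n) K d) : n * (d / 3) ≤ 2 * Φ.size := by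
  have h' : Φ.eval = psum (Fin n) K d + ∑ j : Fin 0, (0 : MvPolynomial (Fin n) K) * 0 + 0 := by
    simp [h]
  have := formula_lower_bound_of_robustHeight hd (robustHeight_psum (by omega) hdK)
    Φ (fun _ => 0) (fun _ => 0) (fun _ => by simp) (fun _ => by simp) 0
    (by rw [totalDegree_zero]; omega) h'
  simpa using this

end CKSV2022

end Literature.Computability.AlgebraicComplexity

end
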